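import Mathlib
import HarnessLib
import Summits.Ventures.LatticeQCDFlow.Exactness.UniformAngleCauchy
import Summits.Ventures.LatticeQCDFlow.Exactness.WoodSampler

/-!
# The CP(N−1) link heat bath: Best–Fisher's von Mises sampler is exact (cosine law)

HONEST FRAMING: exact (Metropolis-corrected) sampling algorithms for lattice gauge theory;
figures of merit are autocorrelation/cost numbers at stated couplings and volumes; no
continuum-physics claim.

Venture `LatticeQCDFlow` (cell pub-lqcd), topic `Exactness`, FANOUT row 9 (eng-latcore, the
engine `latflow.core`).  NEW WORK of the cell over Mathlib and row 9's `RejectionSampling.lean`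
(`loopLaw_thinning`), `UniformAngleCauchy.lean` (`unitLaw`), `WoodSampler.lean` (`vmfCosLaw`).
Nothing is cited as a fact.  Printed counterpart, NAMED ONLY: Best–Fisher 1979 (Appl. Statist. 28).

The `cpn_2d` LINK heat bath draws the deviation `φ − arg G` from the von Mises law
`∝ e^{κ cos φ}dφ`, `κ = 2Nβ|G|` (`heatbath_links`: numpy `rng.vonmises`; C `cpn_kernel.c`
`rng_vonmises`, Best–Fisher):  with `τ = 1 + √(1+4κ²)`, `ρ = (τ − √(2τ))/(2κ)`, `r = (1+ρ²)/(2ρ)`,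
repeat { `z = cos(π u₁)`, `f = (1 + r z)/(r + z)`, `c = κ (r − f)`;
accept iff `c(2−c) − u₂ > 0` or `log(c/u₂) + 1 − c ≥ 0` }, then `φ = ± arccos f` (sign from `u₃`).
This file types the loop for the COSINE `f` in idealised real arithmetic:

* §1 the Möbius map `f = (1 + rz)/(r + z)` of `[−1, 1]` and its inverse `z = (rf − 1)/(r − f)`;
* §2 **`lintegral_bfProposal`** — for ANY `r > 1` the proposal `f(cos(πU))`, `U` uniform, has density
  `√(r²−1)/(π (r − w) √(1−w²))` on `(−1, 1)` (the cosine of a wrapped Cauchy angle), by the change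
  of variables `u = arccos((rw−1)/(r−w))/π`;
* §3 the engine's two-branch test accepts, given `f = w`, with probability EXACTLY `c e^{1−c}`,
  `c = κ(r−w)` (`unitLaw_bfTest`: the first branch `c(2−c) > u₂` is a squeeze inside the second,
  `2 − c ≤ e^{1−c}`; and `c e^{1−c} ≤ 1` always, so the test is a genuine thinning);
* §4 **`loopLaw_bfRound`** — for `κ > 0` and ANY `r > 1` the loop outputs the normalised law
  `(vmfCosLaw κ 1 ℝ)⁻¹ • vmfCosLaw κ 1`, density `∝ e^{κw}/√(1−w²)` on `(−1,1)` = the cosine law of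
  the von Mises distribution; acceptance per round `bfConst κ r · mass`, `bfConst = κ√(r²−1)e^{1−κr}/π`;
* §5 the engine's `r`: `τ > 2`, `0 < ρ < 1`, hence **`one_lt_bfR : 1 < r`**, and the engine instance
  **`loopLaw_bestFisher`**.

NOT CLAIMED: the final angle `± arccos f` (one more pushforward: `e^{κw}dw/√(1−w²) ↦ e^{κ cos φ}dφ`
on `(−π, π)`), the `κ < 1e−8` branch (uniform angle: exact at `κ = 0` only), optimality of Best–Fisher's
`r`, floating point (`acos` clamp); almost-sure termination (finite, non-zero mass) is proved downstream in
`BestFisherAngle.lean`, the value of the mass (`π I₀(κ)`) nowhere.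
-/

namespace Summit.Ventures.LatticeQCDFlow.Exactness

open MeasureTheory Measure Set Real ProbabilityTheory
open scoped ENNReal

section BestFisher

variable {κ r : ℝ}

/-! ## §1 The Möbius map of the cosine and its inverse -/

/-- Best–Fisher's map of the cosine: `f = (1 + r z)/(r + z)`. -/
noncomputable def bfMap (r z : ℝ) : ℝ := (1 + r * z) / (r + z)

/-- Its inverse on `(−1, 1)`: `z = (r w − 1)/(r − w)`. -/
noncomputable def bfZ (r w : ℝ) : ℝ := (r * w - 1) / (r - w)

/-- The engine's proposal from one uniform deviate: `f = bfMap r (cos (π u))`. -/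
noncomputable def bfProposal (r u : ℝ) : ℝ := bfMap r (Real.cos (π * u))

/-- The uniform deviate producing a given cosine: `u = arccos((rw − 1)/(r − w))/π`. -/
noncomputable def bfInv (r w : ℝ) : ℝ := Real.arccos (bfZ r w) / π

/-- `bfMap r` sends `(−1, 1)` into `(−1, 1)` (`r > 1`). -/
theorem bfMap_mem (hr : 1 < r) {z : ℝ} (hz : z ∈ Ioo (-1 : ℝ) 1) : bfMap r z ∈ Ioo (-1 : ℝ) 1 := by
  have hrz : 0 < r + z := by linarith [hz.1]
  rw [bfMap, mem_Ioo, lt_div_iff₀ hrz, div_lt_iff₀ hrz]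
  constructor <;> nlinarith [hz.1, hz.2]

/-- `bfZ r` sends `(−1, 1)` into `(−1, 1)` (`r > 1`). -/
theorem bfZ_mem (hr : 1 < r) {w : ℝ} (hw : w ∈ Ioo (-1 : ℝ) 1) : bfZ r w ∈ Ioo (-1 : ℝ) 1 := by
  have hrw : 0 < r - w := by linarith [hw.2]
  rw [bfZ, mem_Ioo, lt_div_iff₀ hrw, div_lt_iff₀ hrw]
  constructor <;> nlinarith [hw.1, hw.2]

/-- `bfMap r (bfZ r w) = w` on `(−1, 1)`. -/
theorem bfMap_bfZ (hr : 1 < r) {w : ℝ} (hw : w ∈ Ioo (-1 : ℝ) 1) : bfMap r (bfZ r w) = w := by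
  have hrw : r - w ≠ 0 := by linarith [hw.2]
  have hne : r + bfZ r w ≠ 0 := by linarith [(bfZ_mem hr hw).1]
  rw [bfMap, div_eq_iff hne, bfZ]
  field_simp
  ring

/-- `bfZ r (bfMap r z) = z` on `(−1, 1)`. -/
theorem bfZ_bfMap (hr : 1 < r) {z : ℝ} (hz : z ∈ Ioo (-1 : ℝ) 1) : bfZ r (bfMap r z) = z := by
  have hrz : r + z ≠ 0 := by linarith [hz.1]
  have hne : r - bfMap r z ≠ 0 := by linarith [(bfMap_mem hr hz).2]
  rw [bfZ, div_eq_iff hne, bfMap]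
  field_simp
  ring

/-- The proposal map inverts `bfInv` on `(−1, 1)`. -/
theorem bfProposal_bfInv (hr : 1 < r) {w : ℝ} (hw : w ∈ Ioo (-1 : ℝ) 1) :
    bfProposal r (bfInv r w) = w := by
  have hz := bfZ_mem hr hw
  rw [bfProposal, bfInv, mul_div_cancel₀ _ Real.pi_pos.ne', Real.cos_arccos hz.1.le hz.2.le,
    bfMap_bfZ hr hw]

/-- `bfInv r` maps `(−1, 1)` onto `(0, 1)`. -/
theorem image_bfInv (hr : 1 < r) : bfInv r '' Ioo (-1) 1 = Ioo 0 1 := by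
  ext u
  constructor
  · rintro ⟨w, hw, rfl⟩
    have hz := bfZ_mem hr hw
    refine ⟨div_pos (Real.arccos_pos.mpr hz.2) Real.pi_pos, (div_lt_one Real.pi_pos).mpr ?_⟩
    exact Real.arccos_lt_pi.mpr hz.1
  · rintro ⟨h0, h1⟩
    have hπu : π * u ∈ Ioo 0 π := ⟨by positivity, by nlinarith [Real.pi_pos]⟩
    have hz : Real.cos (π * u) ∈ Ioo (-1 : ℝ) 1 := by
      constructor
      · rw [← Real.cos_pi]
        exact Real.strictAntiOn_cos ⟨hπu.1.le, hπu.2.le⟩ ⟨Real.pi_pos.le, le_rfl⟩ hπu.2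
      · rw [← Real.cos_zero]
        exact Real.strictAntiOn_cos ⟨le_rfl, Real.pi_pos.le⟩ ⟨hπu.1.le, hπu.2.le⟩ hπu.1
    refine ⟨bfProposal r u, bfMap_mem hr hz, ?_⟩
    rw [bfInv, bfProposal, bfZ_bfMap hr hz, Real.arccos_cos hπu.1.le hπu.2.le,
      mul_div_cancel_left₀ _ Real.pi_pos.ne']

/-- `1 − z(w)² = (r² − 1)(1 − w²)/(r − w)²`. -/
theorem one_sub_bfZ_sq {w : ℝ} (hw : w < r) :
    1 - bfZ r w ^ 2 = (r ^ 2 - 1) * (1 - w ^ 2) / (r - w) ^ 2 := by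
  have hrw : r - w ≠ 0 := by linarith
  rw [bfZ]
  field_simp
  ring

/-- `√(1 − z(w)²) = √(r²−1) √(1−w²)/(r − w)` on `(−1, 1)`. -/
theorem sqrt_one_sub_bfZ_sq (hr : 1 < r) {w : ℝ} (hw : w ∈ Ioo (-1 : ℝ) 1) :
    Real.sqrt (1 - bfZ r w ^ 2) = Real.sqrt (r ^ 2 - 1) * Real.sqrt (1 - w ^ 2) / (r - w) := by
  have hrw : 0 < r - w := by linarith [hw.2]
  rw [one_sub_bfZ_sq (by linarith [hw.2] : w < r), Real.sqrt_div' _ (sq_nonneg _), Real.sqrt_sq hrw.le,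
    Real.sqrt_mul (by nlinarith)]

/-- The proposal density: `√(r²−1)/(π (r − w) √(1 − w²))`. -/
noncomputable def bfDensity (r w : ℝ) : ℝ :=
  Real.sqrt (r ^ 2 - 1) / (π * (r - w) * Real.sqrt (1 - w ^ 2))

/-- Derivative of `bfZ r`: `(r² − 1)/(r − w)²`. -/
theorem hasDerivAt_bfZ {w : ℝ} (hw : w < r) : HasDerivAt (bfZ r) ((r ^ 2 - 1) / (r - w) ^ 2) w := by
  have hrw : r - w ≠ 0 := by linarith
  have h := (((hasDerivAt_id w).const_mul r).sub_const 1).div ((hasDerivAt_id w).const_sub r) hrw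
  refine (h.congr_deriv ?_)
  simp only [id]
  field_simp
  ring

/-- Derivative of `bfInv r` on `(−1, 1)`: `−bfDensity r w`. -/
theorem hasDerivAt_bfInv (hr : 1 < r) {w : ℝ} (hw : w ∈ Ioo (-1 : ℝ) 1) :
    HasDerivAt (bfInv r) (-bfDensity r w) w := by
  have hz := bfZ_mem hr hw
  have hrw : 0 < r - w := by linarith [hw.2]
  have hs : 0 < Real.sqrt (r ^ 2 - 1) := Real.sqrt_pos.mpr (by nlinarith)
  have ht : 0 < Real.sqrt (1 - w ^ 2) := Real.sqrt_pos.mpr (by nlinarith [hw.1, hw.2])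
  have hs2 : Real.sqrt (r ^ 2 - 1) ^ 2 = r ^ 2 - 1 := Real.sq_sqrt (by nlinarith)
  show HasDerivAt (fun w => Real.arccos (bfZ r w) / π) (-bfDensity r w) w
  have h := ((Real.hasDerivAt_arccos (by linarith [hz.1]) (by linarith [hz.2])).comp w
    (hasDerivAt_bfZ (r := r) (by linarith [hw.2]))).div_const π
  refine h.congr_deriv ?_
  rw [sqrt_one_sub_bfZ_sq hr hw, bfDensity]
  field_simp
  rw [hs2]

/-! ## §2 The law of the proposal -/

/-- The proposal map is measurable. -/
theorem measurable_bfProposal (r : ℝ) : Measurable (bfProposal r) := by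
  unfold bfProposal bfMap; fun_prop

/-- **The proposal law.**  For `r > 1` and every `g ≥ 0`:
`∫ g(bfProposal r u) d unitLaw(u) = ∫_{(−1,1)} √(r²−1)/(π(r−w)√(1−w²)) g(w) dw` — the cosine of a
wrapped Cauchy angle, by the change of variables `u = arccos((rw − 1)/(r − w))/π`. -/
theorem lintegral_bfProposal (hr : 1 < r) (g : ℝ → ℝ≥0∞) :
    ∫⁻ u, g (bfProposal r u) ∂unitLaw = ∫⁻ w in Ioo (-1) 1, ENNReal.ofReal (bfDensity r w) * g w := by
  have hinj : InjOn (bfInv r) (Ioo (-1) 1) := by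
    intro s hs t ht h
    rw [← bfProposal_bfInv hr hs, ← bfProposal_bfInv hr ht, h]
  rw [lintegral_unitLaw, ← image_bfInv hr,
    lintegral_image_eq_lintegral_abs_deriv_mul measurableSet_Ioo
      (fun w hw => (hasDerivAt_bfInv hr hw).hasDerivWithinAt) hinj]
  refine setLIntegral_congr_fun measurableSet_Ioo fun w hw => ?_
  have hrw : 0 < r - w := by linarith [hw.2]
  have hpos : 0 < bfDensity r w := by
    unfold bfDensity
    exact div_pos (Real.sqrt_pos.mpr (by nlinarith))
      (mul_pos (mul_pos Real.pi_pos hrw) (Real.sqrt_pos.mpr (by nlinarith [hw.1, hw.2])))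
  rw [bfProposal_bfInv hr hw, abs_neg, abs_of_pos hpos]

/-! ## §3 The acceptance test -/

/-- `c e^{1−c} ≤ 1` for every real `c`. -/
theorem mul_exp_one_sub_le_one (c : ℝ) : c * Real.exp (1 - c) ≤ 1 := by
  have h1 : c ≤ Real.exp (c - 1) := by linarith [Real.add_one_le_exp (c - 1)]
  have h2 : Real.exp (c - 1) * Real.exp (1 - c) = 1 := by
    rw [← Real.exp_add, show c - 1 + (1 - c) = 0 by ring, Real.exp_zero]
  nlinarith [Real.exp_pos (1 - c)]

/-- **The engine's two-branch test** `c(2−c) − u > 0 ∨ log(c/u) + 1 − c ≥ 0` (`c > 0`, `u > 0`) holds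
iff `u ≤ c e^{1−c}`: the first branch is a squeeze inside the second (`2 − c ≤ e^{1−c}`). -/
theorem bfTest_iff {c u : ℝ} (hc : 0 < c) (hu : 0 < u) :
    (0 < c * (2 - c) - u ∨ 0 ≤ Real.log (c / u) + 1 - c) ↔ u ≤ c * Real.exp (1 - c) := by
  have hsq : c * (2 - c) ≤ c * Real.exp (1 - c) :=
    mul_le_mul_of_nonneg_left (by linarith [Real.add_one_le_exp (1 - c)]) hc.le
  have h2 : 0 ≤ Real.log (c / u) + 1 - c ↔ u ≤ c * Real.exp (1 - c) := by
    rw [show (0 ≤ Real.log (c / u) + 1 - c) ↔ c - 1 ≤ Real.log (c / u) by constructor <;> intro h <;> linarith,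
      Real.le_log_iff_exp_le (by positivity), le_div_iff₀ hu, show (1 : ℝ) - c = -(c - 1) by ring,
      Real.exp_neg, ← div_eq_mul_inv, le_div_iff₀ (Real.exp_pos _), mul_comm]
  constructor
  · rintro (h | h)
    · linarith
    · exact h2.mp h
  · exact fun h => Or.inr (h2.mpr h)

/-- `unitLaw (−∞, v] = min v 1` (as an extended real, clipped below at `0`). -/
theorem unitLaw_Iic (v : ℝ) : unitLaw (Iic v) = ENNReal.ofReal (min v 1) := by
  rw [unitLaw, Measure.restrict_apply measurableSet_Iic]
  rcases le_or_gt 1 v with h | h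
  · rw [min_eq_right h, show Iic v ∩ Ioo (0 : ℝ) 1 = Ioo 0 1 by
      ext u; simp only [mem_inter_iff, mem_Iic, mem_Ioo]; constructor
      · exact fun h' => h'.2
      · exact fun h' => ⟨by linarith [h'.2], h'⟩, Real.volume_Ioo, sub_zero]
  · rw [min_eq_left h.le, show Iic v ∩ Ioo (0 : ℝ) 1 = Ioc 0 v by
      ext u; simp only [mem_inter_iff, mem_Iic, mem_Ioo, mem_Ioc]; constructor
      · exact fun h' => ⟨h'.2.1, h'.1⟩
      · exact fun h' => ⟨h'.2, h'.1, by linarith [h'.2]⟩, Real.volume_Ioc, sub_zero]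

/-- **The test accepts with probability exactly `c e^{1−c}`** (`c > 0`; `u₂` uniform). -/
theorem unitLaw_bfTest {c : ℝ} (hc : 0 < c) :
    unitLaw {u : ℝ | 0 < c * (2 - c) - u ∨ 0 ≤ Real.log (c / u) + 1 - c} =
      ENNReal.ofReal (c * Real.exp (1 - c)) := by
  have hae : {u : ℝ | 0 < c * (2 - c) - u ∨ 0 ≤ Real.log (c / u) + 1 - c} =ᵐ[unitLaw]
      Iic (c * Real.exp (1 - c)) := by
    rw [unitLaw]
    filter_upwards [ae_restrict_mem measurableSet_Ioo] with u hu
    simp only [eq_iff_iff]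
    exact bfTest_iff hc hu.1
  rw [measure_congr hae, unitLaw_Iic, min_eq_left (mul_exp_one_sub_le_one c)]

/-- The acceptance probability given the proposed cosine `w`: `c e^{1−c}`, `c = κ(r − w)`. -/
noncomputable def bfAccept (κ r w : ℝ) : ℝ≥0∞ :=
  ENNReal.ofReal (κ * (r - w) * Real.exp (1 - κ * (r - w)))

/-- `bfAccept` is measurable. -/
theorem measurable_bfAccept (κ r : ℝ) : Measurable (bfAccept κ r) := by
  unfold bfAccept; fun_prop

/-- `bfAccept ≤ 1`: the test is a genuine thinning. -/
theorem bfAccept_le_one (κ r w : ℝ) : bfAccept κ r w ≤ 1 :=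
  ENNReal.ofReal_le_one.mpr (mul_exp_one_sub_le_one _)

/-- Best–Fisher's constant `κ √(r²−1) e^{1−κr}/π` (acceptance per round = constant × mass). -/
noncomputable def bfConst (κ r : ℝ) : ℝ≥0∞ :=
  ENNReal.ofReal (κ * Real.sqrt (r ^ 2 - 1) * Real.exp (1 - κ * r) / π)

/-- `bfConst ≠ 0` for `κ > 0`, `r > 1`. -/
theorem bfConst_ne_zero (hκ : 0 < κ) (hr : 1 < r) : bfConst κ r ≠ 0 := by
  rw [bfConst, Ne, ENNReal.ofReal_eq_zero, not_le]
  exact div_pos (mul_pos (mul_pos hκ (Real.sqrt_pos.mpr (by nlinarith))) (Real.exp_pos _)) Real.pi_pos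

/-- The density identity on `(−1, 1)`:
`√(r²−1)/(π(r−w)√(1−w²)) · κ(r−w)e^{1−κ(r−w)} = bfConst · (1−w²)^{−1/2} e^{κw}`. -/
theorem bf_pointwise (hκ : 0 < κ) (hr : 1 < r) {w : ℝ} (hw : w ∈ Ioo (-1 : ℝ) 1) :
    ENNReal.ofReal (bfDensity r w) * bfAccept κ r w =
      bfConst κ r * ENNReal.ofReal ((1 - w ^ 2) ^ ((1 : ℝ) / 2 - 1) * Real.exp (κ * w)) := by
  have hrw : 0 < r - w := by linarith [hw.2]
  have h1w : 0 < 1 - w ^ 2 := by nlinarith [hw.1, hw.2]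
  have hs : 0 < Real.sqrt (r ^ 2 - 1) := Real.sqrt_pos.mpr (by nlinarith)
  have ht : 0 < Real.sqrt (1 - w ^ 2) := Real.sqrt_pos.mpr h1w
  have hd : 0 ≤ bfDensity r w := by unfold bfDensity; positivity
  have hrpow : (1 - w ^ 2) ^ ((1 : ℝ) / 2 - 1) = (Real.sqrt (1 - w ^ 2))⁻¹ := by
    rw [show (1 : ℝ) / 2 - 1 = -(1 / 2) by norm_num, Real.rpow_neg h1w.le, ← Real.sqrt_eq_rpow]
  have hexp : Real.exp (1 - κ * (r - w)) = Real.exp (1 - κ * r) * Real.exp (κ * w) := by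
    rw [← Real.exp_add]; ring_nf
  rw [bfAccept, bfConst, ← ENNReal.ofReal_mul hd, ← ENNReal.ofReal_mul (by positivity), hrpow, hexp,
    bfDensity]
  congr 1
  field_simp

/-! ## §4 The loop -/

/-- **One Best–Fisher round** (cosine part): propose `bfProposal r u₁`, accept with `bfAccept`. -/
noncomputable def bfRound (κ r : ℝ) : Measure (ℝ × Bool) :=
  (unitLaw.map (bfProposal r)) ⊗ₘ coin (bfAccept κ r)

/-- The accepted part of the proposal law is `bfConst • vmfCosLaw κ 1`. -/
theorem withDensity_bfProposal (hκ : 0 < κ) (hr : 1 < r) :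
    (unitLaw.map (bfProposal r)).withDensity (bfAccept κ r) = bfConst κ r • vmfCosLaw κ 1 := by
  ext A hA
  rw [withDensity_apply _ hA, Measure.smul_apply, smul_eq_mul, vmfCosLaw, withDensity_apply _ hA,
    Measure.restrict_restrict hA, ← lintegral_indicator hA,
    lintegral_map ((measurable_bfAccept κ r).indicator hA) (measurable_bfProposal r),
    lintegral_bfProposal hr]
  have hL : ∫⁻ w in Ioo (-1) 1, ENNReal.ofReal (bfDensity r w) * A.indicator (bfAccept κ r) w =
      ∫⁻ w in A ∩ Ioo (-1) 1, ENNReal.ofReal (bfDensity r w) * bfAccept κ r w := by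
    rw [← Measure.restrict_restrict hA, ← lintegral_indicator hA]
    refine lintegral_congr fun w => ?_
    by_cases h : w ∈ A
    · rw [indicator_of_mem h, indicator_of_mem h]
    · rw [indicator_of_notMem h, indicator_of_notMem h, mul_zero]
  have hKt : bfConst κ r ≠ ∞ := ENNReal.ofReal_ne_top
  rw [hL, ← lintegral_const_mul' (bfConst κ r) _ hKt]
  refine setLIntegral_congr_fun (hA.inter measurableSet_Ioo) fun w hw => ?_
  rw [show (1 : ℝ) / 2 - 1 = (1 : ℝ) / 2 - 1 from rfl]
  exact bf_pointwise hκ hr hw.2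

/-- **Cost**: one round accepts with probability `bfConst κ r · vmfCosLaw κ 1 ℝ`. -/
theorem bfRound_accept (hκ : 0 < κ) (hr : 1 < r) :
    bfRound κ r (univ ×ˢ {true}) = bfConst κ r * vmfCosLaw κ 1 univ := by
  haveI : IsProbabilityMeasure (unitLaw.map (bfProposal r)) :=
    isProbabilityMeasure_map (measurable_bfProposal r).aemeasurable
  rw [bfRound, thinning_accept _ (measurable_bfAccept κ r) (bfAccept_le_one κ r),
    ← setLIntegral_univ, ← withDensity_apply _ MeasurableSet.univ, withDensity_bfProposal hκ hr,
    Measure.smul_apply, smul_eq_mul]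

/-- **BEST–FISHER'S LOOP IS EXACT (cosine law).**  For `κ > 0` and ANY `r > 1`, repeating the round
until the first acceptance outputs `(vmfCosLaw κ 1 ℝ)⁻¹ • vmfCosLaw κ 1`, density `∝ e^{κw}/√(1−w²)`
on `(−1, 1)` — the law of `cos φ` for `φ` von Mises with concentration `κ`. -/
theorem loopLaw_bfRound (hκ : 0 < κ) (hr : 1 < r) :
    loopLaw (bfRound κ r) = (vmfCosLaw κ 1 univ)⁻¹ • vmfCosLaw κ 1 := by
  haveI : IsProbabilityMeasure (unitLaw.map (bfProposal r)) :=
    isProbabilityMeasure_map (measurable_bfProposal r).aemeasurable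
  have hK0 := bfConst_ne_zero hκ hr
  have hKt : bfConst κ r ≠ ∞ := ENNReal.ofReal_ne_top
  rw [bfRound, loopLaw_thinning _ (measurable_bfAccept κ r) (bfAccept_le_one κ r),
    ← setLIntegral_univ, ← withDensity_apply _ MeasurableSet.univ, withDensity_bfProposal hκ hr,
    Measure.smul_apply, smul_eq_mul, smul_smul, ENNReal.mul_inv (Or.inl hK0) (Or.inl hKt),
    mul_comm (bfConst κ r)⁻¹, mul_assoc, ENNReal.inv_mul_cancel hK0 hKt, mul_one]

/-! ## §5 The engine's constants -/

/-- `τ = 1 + √(1 + 4κ²)`. -/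
noncomputable def bfTau (κ : ℝ) : ℝ := 1 + Real.sqrt (1 + 4 * κ ^ 2)

/-- `ρ = (τ − √(2τ))/(2κ)`. -/
noncomputable def bfRho (κ : ℝ) : ℝ := (bfTau κ - Real.sqrt (2 * bfTau κ)) / (2 * κ)

/-- `r = (1 + ρ²)/(2ρ)`. -/
noncomputable def bfR (κ : ℝ) : ℝ := (1 + bfRho κ ^ 2) / (2 * bfRho κ)

/-- `τ > 2` for `κ > 0`. -/
theorem two_lt_bfTau (hκ : 0 < κ) : 2 < bfTau κ := by
  have : 1 < Real.sqrt (1 + 4 * κ ^ 2) := by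
    have h := Real.sqrt_lt_sqrt zero_le_one (show (1 : ℝ) < 1 + 4 * κ ^ 2 by nlinarith)
    rwa [Real.sqrt_one] at h
  rw [bfTau]; linarith

/-- `(τ − 1)² = 1 + 4κ²`, i.e. `τ² − 2τ = 4κ²`. -/
theorem bfTau_sq (κ : ℝ) : bfTau κ ^ 2 - 2 * bfTau κ = 4 * κ ^ 2 := by
  have h := Real.sq_sqrt (show (0 : ℝ) ≤ 1 + 4 * κ ^ 2 by positivity)
  rw [bfTau]; nlinarith

/-- `0 < ρ < 1` for `κ > 0`. -/
theorem bfRho_mem (hκ : 0 < κ) : bfRho κ ∈ Ioo (0 : ℝ) 1 := by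
  have hτ := two_lt_bfTau hκ
  have hτ2 := bfTau_sq κ
  have hs0 : 0 ≤ Real.sqrt (2 * bfTau κ) := Real.sqrt_nonneg _
  have hs2 : Real.sqrt (2 * bfTau κ) ^ 2 = 2 * bfTau κ := Real.sq_sqrt (by linarith)
  have hs : 2 < Real.sqrt (2 * bfTau κ) := by nlinarith
  have hlt : Real.sqrt (2 * bfTau κ) < bfTau κ := by nlinarith
  refine ⟨div_pos (by linarith) (by linarith), (div_lt_one (by linarith)).mpr ?_⟩
  have hsq : (bfTau κ - Real.sqrt (2 * bfTau κ)) ^ 2 < (2 * κ) ^ 2 := by nlinarith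
  exact (pow_lt_pow_iff_left₀ (by linarith) (by linarith) two_ne_zero).mp hsq

/-- **`r > 1`** for `κ > 0` (so §4 applies to the engine's loop). -/
theorem one_lt_bfR (hκ : 0 < κ) : 1 < bfR κ := by
  obtain ⟨h0, h1⟩ := bfRho_mem hκ
  rw [bfR, lt_div_iff₀ (by linarith)]
  nlinarith [sq_pos_of_pos (show 0 < 1 - bfRho κ by linarith)]

/-- **THE ENGINE'S BEST–FISHER LOOP IS EXACT (cosine law)**, `κ > 0`: with the engine's
`r = (1+ρ²)/(2ρ)` the loop outputs `(vmfCosLaw κ 1 ℝ)⁻¹ • vmfCosLaw κ 1`. -/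
theorem loopLaw_bestFisher (hκ : 0 < κ) :
    loopLaw (bfRound κ (bfR κ)) = (vmfCosLaw κ 1 univ)⁻¹ • vmfCosLaw κ 1 :=
  loopLaw_bfRound hκ (one_lt_bfR hκ)

end BestFisher

end Summit.Ventures.LatticeQCDFlow.Exactness
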